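import Summits.NavierStokesRegularity.NavierStokesRegularity.Theorems.LerayQuarterDissipationFiniteDissipationLiouvilleTraceSupport
import Summits.NavierStokesRegularity.NavierStokesRegularity.Theorems.LerayQuarterDissipationFiniteDissipationLiouvilleTraceEpsilon
import Literature.Analysis.FluidPDE.LocalLerayBackwardUniquenessHalfSpace
import HarnessLib

/-!
# Crux `FiniteDissipationLiouville` (stmt-NavierStokesRegularity-22144): BACKWARD UNIQUENESS FROM
# ONE HALF-SPACE — a member of the stratum whose final datum vanishes on a half-space `{x₃ > R₁}`
# is trivial; the final datum of every nonzero member is nontrivial in EVERY such half-space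

Theorems file of route `LerayQuarterDissipation` (lead prover g5; `--supports` the crux: a
directional sharpening of the far-field trace leaf `…TraceSupport`, bearing on BOTH registered
stubs of the line `birth`, for every member). Navier–Stokes regularity is NOT proved by anything
here; no summit is.

`𝒟_{C,K}`: Type-I ancient mild fields `u` (`IsTypeIAncientMild C u`) with the quarter-rate law;
`T_u(φ) = lim_{t→0⁻} ∫⟪u(t), φ⟫` the distributional trace at the singular time (lead g3).
`…TraceSupport` proved: trace vanishing OUTSIDE A BALL ⇒ `u ≡ 0`. Escauriaza–Seregin–Šverák's
backward uniqueness for the vorticity is a HALF-SPACE theorem; this lead's Literature files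
`ESSFarFieldVorticityHalfSpace`, `ESSFarFieldVorticityHalfSpaceFrame`,
`LocalLerayBackwardUniquenessHalfSpace` carry the half-space through Lemarié-Rieusset's Thm. 15.4.
Hence, on `𝒟`:

* `eq_zero_of_trace_halfSpace_vanishing` — **if `∫⟪u(t), φ⟫ → 0` as `t → 0⁻` for every test field
  `φ` supported in the half-space `{x₃ > R₁}` (some `R₁`), then `u ≡ 0` on `t < 0`.**
* `not_singular_of_trace_halfSpace_vanishing`, `exists_halfSpace_trace_ne_zero_of_ne_zero`,
  `exists_halfSpace_trace_ne_zero_of_singular` — regularity form and PORTRAIT: **the final datum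
  of every nonzero member — a fortiori of every singular one, past-DSS or past-wandering — is
  nontrivial in EVERY half-space `{x₃ > R₁}`**: it cannot be supported in a half-space
  `{x₃ ≤ R₁}`. For the DSS wall, whose trace is the homogeneous datum `a(x̂)|x|⁻¹` (lead g3), this
  is an ANGULAR constraint on blow-up profiles: `a` does not vanish identically on the open upper
  hemisphere `{x̂₃ > 0}`; by the rotation covariance of the equations (the class `𝒟_{C,K}` is
  `O(3)`-invariant, `CalmSliceGate….stub_isometryPullback`; not re-derived here) the same holds
  for every open hemisphere and every half-space `{⟪x, e⟫ > R₁}`.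
* `exists_trace_epsilon_halfSpace`, `trace_L3_halfSpace_floor_of_singular` — the UNIFORM form:
  there is `ε₂(C,K) > 0` such that dual-`L³` mass of the trace `≤ ε₂` on ONE half-space
  `{x₃ > R}` forces regularity at the apex; the final datum of a singular member carries dual-`L³`
  mass `> ε₂` on EVERY half-space `{x₃ > R}` (dilation invariance + compactness + the half-space
  trace leaf on the singular limit).
* `finiteDissipationLiouville_iff_halfSpaceTrace` — bookkeeping.

References: P. G. Lemarié-Rieusset (2016), Thm. 15.4; L. Escauriaza, G. Seregin, V. Šverák,
Russ. Math. Surveys 58 (2003), §3, Thm. 5.1, §5.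
-/

noncomputable section

-- the summit and its single sub-problem share the name (CONVENTIONS §1), as in every Theorems file
set_option linter.dupNamespace false

namespace Summit.NavierStokesRegularity.NavierStokesRegularity.Theorems.FiniteDissipationLiouville.Birth.Apex

open MeasureTheory Set Filter Topology Metric Function TopologicalSpace
open Literature.Analysis Literature.Analysis.FluidPDE
open scoped ENNReal NNReal RealInnerProductSpace

variable {C K : ℝ} {u : ℝ → EuclideanSpace ℝ (Fin 3) → EuclideanSpace ℝ (Fin 3)}

/-! ### The half-space trace leaf -/

/-- **THE HALF-SPACE TRACE LEAF.** A member of the finite-dissipation stratum whose slices tend to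
`0` in `𝒟'({x₃ > R₁})` as `t → 0⁻` — `∫ ⟪u(t), φ⟫ → 0` for every smooth compactly supported field
`φ` supported in the half-space `{x₃ > R₁}` — vanishes identically on `t < 0` (the shifted field is
a local Leray solution on `(0, T) × ℝ³` whose final value vanishes on a half-space; the half-space
form of Lemarié-Rieusset's backward uniqueness theorem,
`IsLocalLeraySolutionOn.ae_zero_of_halfSpace_final_vanishing_unit`; continuity). -/
theorem eq_zero_of_trace_halfSpace_vanishing (hu : IsTypeIAncientMild C u)
    (hlaw : ∀ s : ℝ, s < 0 → ∫⁻ x, ‖fderiv ℝ (u s) x‖ₑ ^ 2 ≤ ENNReal.ofReal (K / Real.sqrt (-s)))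
    {R₁ : ℝ}
    (hfinal : ∀ φ : EuclideanSpace ℝ (Fin 3) → EuclideanSpace ℝ (Fin 3),
      FunctionSpaces.IsTestFunctionOn (⊤ : Opens (EuclideanSpace ℝ (Fin 3))) φ →
        (∀ x, φ x ≠ 0 → R₁ < x 2) →
        Tendsto (fun t => ∫ x, ⟪u t x, φ x⟫) (𝓝[<] 0) (𝓝 0)) :
    ∀ t < 0, ∀ x, u t x = 0 := by
  intro t ht x
  set T : ℝ := -2 * t with hT
  have hT0 : 0 < T := by rw [hT]; linarith
  obtain ⟨π, hLL⟩ := exists_isLocalLeraySolutionOn_shift hu hlaw hT0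
  have hdiv : IsWeaklyDivFree (u (-T)) := hu.isWeaklyDivFree (by linarith)
  have hmap : Tendsto (fun s : ℝ => s - T) (𝓝[<] T) (𝓝[<] 0) := by
    refine tendsto_nhdsWithin_of_tendsto_nhds_of_eventually_within _ ?_ ?_
    · have h : Tendsto (fun s : ℝ => s - T) (𝓝 T) (𝓝 0) := by
        have h1 := (continuous_sub_right T).tendsto T
        simpa using h1
      exact h.mono_left nhdsWithin_le_nhds
    · filter_upwards [self_mem_nhdsWithin] with s hs
      show s - T < 0
      have hs' : s < T := hs
      linarith
  have hfinal' : ∀ φ : EuclideanSpace ℝ (Fin 3) → EuclideanSpace ℝ (Fin 3),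
      FunctionSpaces.IsTestFunctionOn (⊤ : Opens (EuclideanSpace ℝ (Fin 3))) φ →
        (∀ y, φ y ≠ 0 → R₁ < y 2) →
        Tendsto (fun s => ∫ y, ⟪(fun s => u (s - T)) s y, φ y⟫) (𝓝[<] T) (𝓝 0) :=
    fun φ hφ hφsupp => (hfinal φ hφ hφsupp).comp hmap
  have hae := hLL.ae_zero_of_halfSpace_final_vanishing_unit hT0 hdiv hfinal'
  have hsub : Ioo 0 T ×ˢ (univ : Set (EuclideanSpace ℝ (Fin 3))) ⊆
      (fun z : ℝ × EuclideanSpace ℝ (Fin 3) => (z.1 - T, z.2)) ⁻¹' (Iio 0 ×ˢ univ) := by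
    intro z hz
    exact ⟨by have := (mem_prod.1 hz).1.2; show z.1 - T < 0; linarith, mem_univ _⟩
  have hcont : ContinuousOn (fun z : ℝ × EuclideanSpace ℝ (Fin 3) => u (z.1 - T) z.2)
      (Ioo 0 T ×ˢ univ) := by
    have h1 : Continuous fun z : ℝ × EuclideanSpace ℝ (Fin 3) => (z.1 - T, z.2) := by fun_prop
    exact (hu.continuousOn_uncurry.comp h1.continuousOn hsub :)
  have h0 := norm_le_of_ae_le_of_continuousOn (K := 0) (isOpen_Ioo.prod isOpen_univ) hcont
    (hae.mono fun z hz => by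
      show ‖u (z.1 - T) z.2‖ ≤ 0
      rw [show u (z.1 - T) z.2 = 0 from hz, norm_zero])
  have hz : ((t + T, x) : ℝ × EuclideanSpace ℝ (Fin 3)) ∈
      Ioo 0 T ×ˢ (univ : Set (EuclideanSpace ℝ (Fin 3))) :=
    ⟨⟨by rw [hT]; linarith, by linarith⟩, mem_univ _⟩
  have h1 := h0 _ hz
  simp only [add_sub_cancel_right] at h1
  exact norm_le_zero_iff.1 h1

/-- **The half-space trace leaf, regularity form.** -/
theorem not_singular_of_trace_halfSpace_vanishing (hu : IsTypeIAncientMild C u)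
    (hlaw : ∀ s : ℝ, s < 0 → ∫⁻ x, ‖fderiv ℝ (u s) x‖ₑ ^ 2 ≤ ENNReal.ofReal (K / Real.sqrt (-s)))
    {R₁ : ℝ}
    (hfinal : ∀ φ : EuclideanSpace ℝ (Fin 3) → EuclideanSpace ℝ (Fin 3),
      FunctionSpaces.IsTestFunctionOn (⊤ : Opens (EuclideanSpace ℝ (Fin 3))) φ →
        (∀ x, φ x ≠ 0 → R₁ < x 2) →
        Tendsto (fun t => ∫ x, ⟪u t x, φ x⟫) (𝓝[<] 0) (𝓝 0)) :
    ¬ (∀ r > 0, ∀ M : ℝ, ∃ t ∈ Set.Ioo (-(r ^ 2)) (0 : ℝ),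
        ∃ x ∈ Metric.ball (0 : EuclideanSpace ℝ (Fin 3)) r, M < ‖u t x‖) := by
  intro hsing
  obtain ⟨t, ht, x, -, hM⟩ := hsing 1 one_pos 0
  rw [eq_zero_of_trace_halfSpace_vanishing hu hlaw hfinal t ht.2 x, norm_zero] at hM
  exact lt_irrefl _ hM

/-! ### Portrait: the final datum of a nonzero member is nontrivial in every half-space -/

/-- **PORTRAIT ENTRY: the final datum of every NONZERO member of the stratum is nontrivial in
every half-space `{x₃ > R₁}`**: some test field supported there has a nonzero trace value. -/
theorem exists_halfSpace_trace_ne_zero_of_ne_zero (hu : IsTypeIAncientMild C u)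
    (hlaw : ∀ s : ℝ, s < 0 → ∫⁻ x, ‖fderiv ℝ (u s) x‖ₑ ^ 2 ≤ ENNReal.ofReal (K / Real.sqrt (-s)))
    (hne : ∃ t < 0, ∃ x, u t x ≠ 0) (R₁ : ℝ) :
    ∃ (φ : EuclideanSpace ℝ (Fin 3) → EuclideanSpace ℝ (Fin 3)) (L : ℝ),
      FunctionSpaces.IsTestFunctionOn (⊤ : Opens (EuclideanSpace ℝ (Fin 3))) φ ∧
        (∀ x, φ x ≠ 0 → R₁ < x 2) ∧ L ≠ 0 ∧
        Tendsto (fun t => ∫ x, ⟪u t x, φ x⟫) (𝓝[<] 0) (𝓝 L) := by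
  by_contra h
  push Not at h
  obtain ⟨t, ht, x, hx⟩ := hne
  refine hx (eq_zero_of_trace_halfSpace_vanishing hu hlaw (R₁ := R₁) (fun φ hφ hφsupp => ?_) t ht x)
  obtain ⟨L, hL⟩ := exists_tendsto_pairing_finalSlice hu hlaw hφ
  have hL0 : L = 0 := by
    by_contra hL0
    exact h φ L hφ hφsupp hL0 hL
  rwa [hL0] at hL

/-- **PORTRAIT ENTRY (both stubs): the final datum of every SINGULAR member of the stratum —
past-DSS or past-wandering recurrent — is nontrivial in every half-space `{x₃ > R₁}`.** For the
homogeneous datum `a(x̂)|x|⁻¹` of a DSS blow-up profile: `a ≢ 0` on the open upper hemisphere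
(and, by rotation covariance, on every open hemisphere). -/
theorem exists_halfSpace_trace_ne_zero_of_singular (hu : IsTypeIAncientMild C u)
    (hlaw : ∀ s : ℝ, s < 0 → ∫⁻ x, ‖fderiv ℝ (u s) x‖ₑ ^ 2 ≤ ENNReal.ofReal (K / Real.sqrt (-s)))
    (hsing : ∀ r > 0, ∀ M : ℝ, ∃ t ∈ Set.Ioo (-(r ^ 2)) (0 : ℝ),
      ∃ x ∈ Metric.ball (0 : EuclideanSpace ℝ (Fin 3)) r, M < ‖u t x‖) (R₁ : ℝ) :
    ∃ (φ : EuclideanSpace ℝ (Fin 3) → EuclideanSpace ℝ (Fin 3)) (L : ℝ),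
      FunctionSpaces.IsTestFunctionOn (⊤ : Opens (EuclideanSpace ℝ (Fin 3))) φ ∧
        (∀ x, φ x ≠ 0 → R₁ < x 2) ∧ L ≠ 0 ∧
        Tendsto (fun t => ∫ x, ⟪u t x, φ x⟫) (𝓝[<] 0) (𝓝 L) := by
  refine exists_halfSpace_trace_ne_zero_of_ne_zero hu hlaw ?_ R₁
  obtain ⟨t, ht, x, -, hM⟩ := hsing 1 one_pos 0
  refine ⟨t, ht.2, x, fun h0 => ?_⟩
  rw [h0, norm_zero] at hM
  exact lt_irrefl _ hM


/-! ### One-half-space ε-regularity with a uniform threshold -/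

/-- **The dual-`L³` smallness of the trace on a half-space `{x₃ > R}` is dilation invariant
(normalisation to `{x₃ > 1}`).** -/
theorem trace_L3small_halfSpace_nsRescale (hu : IsTypeIAncientMild C u)
    (hlaw : ∀ s : ℝ, s < 0 → ∫⁻ x, ‖fderiv ℝ (u s) x‖ₑ ^ 2 ≤ ENNReal.ofReal (K / Real.sqrt (-s)))
    {R ε : ℝ} (hR : 0 < R)
    (hsmall : ∀ ψ : EuclideanSpace ℝ (Fin 3) → EuclideanSpace ℝ (Fin 3),
      FunctionSpaces.IsTestFunctionOn (⊤ : Opens (EuclideanSpace ℝ (Fin 3))) ψ →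
      (∀ x, ψ x ≠ 0 → R < x 2) →
      ∀ T : ℝ, Tendsto (fun t => ∫ x, ⟪u t x, ψ x⟫) (𝓝[<] 0) (𝓝 T) →
        |T| ≤ ε * (∫ x, ‖ψ x‖ ^ (3 / 2 : ℝ)) ^ (2 / 3 : ℝ)) :
    ∀ ψ : EuclideanSpace ℝ (Fin 3) → EuclideanSpace ℝ (Fin 3),
      FunctionSpaces.IsTestFunctionOn (⊤ : Opens (EuclideanSpace ℝ (Fin 3))) ψ →
      (∀ x, ψ x ≠ 0 → 1 < x 2) →
      ∀ T : ℝ, Tendsto (fun t => ∫ x, ⟪nsRescale R u t x, ψ x⟫) (𝓝[<] 0) (𝓝 T) →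
        |T| ≤ ε * (∫ x, ‖ψ x‖ ^ (3 / 2 : ℝ)) ^ (2 / 3 : ℝ) := by
  intro ψ hψ hsupp T hT
  obtain ⟨T', hT'⟩ := exists_tendsto_pairing_finalSlice hu hlaw
    (hψ.comp_smul_top (inv_ne_zero hR.ne'))
  have hTv := tendsto_pairing_nsRescale (w := u) hR hT'
  have hTeq : T = (R ^ 2)⁻¹ * T' := tendsto_nhds_unique hT hTv
  -- the dilated field is supported in `{x₃ > R}`
  have hsupp' : ∀ x, ψ (R⁻¹ • x) ≠ 0 → R < x 2 := fun x hx => by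
    have h := hsupp _ hx
    rw [PiLp.smul_apply, smul_eq_mul] at h
    rwa [lt_inv_mul_iff₀ hR, mul_one] at h
  have h := hsmall _ (hψ.comp_smul_top (inv_ne_zero hR.ne')) hsupp' T' hT'
  rw [integral_comp_inv_smul_eq (g := fun x => ‖ψ x‖ ^ (3 / 2 : ℝ)) hR] at h
  set I : ℝ := ∫ x, ‖ψ x‖ ^ (3 / 2 : ℝ) with hI
  have hI0 : 0 ≤ I := integral_nonneg fun _ => Real.rpow_nonneg (norm_nonneg _) _
  have hpow : (R ^ 3 * I) ^ (2 / 3 : ℝ) = R ^ 2 * I ^ (2 / 3 : ℝ) := by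
    rw [Real.mul_rpow (pow_nonneg hR.le 3) hI0]
    congr 1
    rw [← Real.rpow_natCast R 3, ← Real.rpow_mul hR.le]
    norm_num
  rw [hpow] at h
  have hR2 : 0 < R ^ 2 := by positivity
  rw [hTeq, abs_mul, abs_of_pos (inv_pos.2 hR2)]
  calc (R ^ 2)⁻¹ * |T'| ≤ (R ^ 2)⁻¹ * (ε * (R ^ 2 * I ^ (2 / 3 : ℝ))) :=
        mul_le_mul_of_nonneg_left h (inv_nonneg.2 hR2.le)
    _ = ε * I ^ (2 / 3 : ℝ) := by field_simp

/-- **ONE-HALF-SPACE ε-REGULARITY, threshold depending on `(C, K)` only.** For all `C, K` there is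
`ε₂ > 0` such that: if `u ∈ 𝒟_{C,K}` and, for SOME `R > 0`, every test field `ψ` supported in the
half-space `{x₃ > R}` has trace value `|T_u(ψ)| ≤ ε₂ ‖ψ‖_{L^{3/2}}`, then `u` is NOT singular at the
apex (dilation invariance of the dual-`L³` quantity and of the half-spaces `{x₃ > R}`; compactness
across members; the singular limit has trace vanishing on `{x₃ > 1}`, impossible by the half-space
trace leaf). So the final datum of every apex-singular member carries dual-`L³` mass `> ε₂(C,K)` on
EVERY half-space `{x₃ > R}` — a scale-free directional floor (for the DSS wall: on the homogeneous
datum `a(x̂)|x|⁻¹`, a quantitative nontriviality on the upper hemisphere). -/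
theorem exists_trace_epsilon_halfSpace (C K : ℝ) : ∃ ε₂ > 0,
    ∀ (u : ℝ → EuclideanSpace ℝ (Fin 3) → EuclideanSpace ℝ (Fin 3)),
      IsTypeIAncientMild C u →
      (∀ s : ℝ, s < 0 → ∫⁻ x, ‖fderiv ℝ (u s) x‖ₑ ^ 2 ≤ ENNReal.ofReal (K / Real.sqrt (-s))) →
      ∀ R > 0,
      (∀ ψ : EuclideanSpace ℝ (Fin 3) → EuclideanSpace ℝ (Fin 3),
        FunctionSpaces.IsTestFunctionOn (⊤ : Opens (EuclideanSpace ℝ (Fin 3))) ψ →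
        (∀ x, ψ x ≠ 0 → R < x 2) →
        ∀ T : ℝ, Tendsto (fun t => ∫ x, ⟪u t x, ψ x⟫) (𝓝[<] 0) (𝓝 T) →
          |T| ≤ ε₂ * (∫ x, ‖ψ x‖ ^ (3 / 2 : ℝ)) ^ (2 / 3 : ℝ)) →
      ¬ (∀ r > 0, ∀ M : ℝ, ∃ t ∈ Set.Ioo (-(r ^ 2)) (0 : ℝ),
          ∃ x ∈ Metric.ball (0 : EuclideanSpace ℝ (Fin 3)) r, M < ‖u t x‖) := by
  by_contra hcon
  push Not at hcon
  have hseq : ∀ k : ℕ, ∃ (v : ℝ → EuclideanSpace ℝ (Fin 3) → EuclideanSpace ℝ (Fin 3)),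
      IsTypeIAncientMild C v ∧
      (∀ s : ℝ, s < 0 → ∫⁻ x, ‖fderiv ℝ (v s) x‖ₑ ^ 2 ≤ ENNReal.ofReal (K / Real.sqrt (-s))) ∧
      (∀ ψ : EuclideanSpace ℝ (Fin 3) → EuclideanSpace ℝ (Fin 3),
        FunctionSpaces.IsTestFunctionOn (⊤ : Opens (EuclideanSpace ℝ (Fin 3))) ψ →
        (∀ x, ψ x ≠ 0 → 1 < x 2) →
        ∀ T : ℝ, Tendsto (fun t => ∫ x, ⟪v t x, ψ x⟫) (𝓝[<] 0) (𝓝 T) →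
          |T| ≤ 1 / ((k : ℝ) + 1) * (∫ x, ‖ψ x‖ ^ (3 / 2 : ℝ)) ^ (2 / 3 : ℝ)) ∧
      (∀ r > 0, ∀ M : ℝ, ∃ t ∈ Set.Ioo (-(r ^ 2)) (0 : ℝ),
          ∃ x ∈ Metric.ball (0 : EuclideanSpace ℝ (Fin 3)) r, M < ‖v t x‖) := by
    intro k
    obtain ⟨u, hu, hlaw, R, hR, hsmall, hsing⟩ := hcon (1 / ((k : ℝ) + 1)) (by positivity)
    exact ⟨nsRescale R u, hu.nsRescale hR, RecurrentReductionD.dissipationLaw_nsRescale hlaw hR,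
      trace_L3small_halfSpace_nsRescale hu hlaw hR hsmall,
      RecurrentReductionD.singularAtOrigin_nsRescale hsing hR⟩
  choose v hv hvlaw hvsmall hvsing using hseq
  obtain ⟨ψs, hψs, W, hW, hunif, hpt, hgrad⟩ := Compactness.seqLimit hv
  have hψt : Tendsto ψs atTop atTop := hψs.tendsto_atTop
  have hWlaw : ∀ s : ℝ, s < 0 →
      ∫⁻ x, ‖fderiv ℝ (W s) x‖ₑ ^ 2 ≤ ENNReal.ofReal (K / Real.sqrt (-s)) :=
    Compactness.law_of_seqLimit (Kinf := K) (Kk := fun _ => K) hψt hvlaw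
      (fun ε hε => Eventually.of_forall fun _ => by linarith) hgrad
  have hWsing := Compactness.persistent_singularity_seq (w := fun j => v (ψs j))
    (fun j => hv (ψs j)) (fun j => hvlaw (ψs j)) (fun j => hvsing (ψs j)) hW hunif
  -- ### the trace of `W` vanishes outside `B̄(0, 1)`: backward uniqueness from infinity
  refine not_singular_of_trace_halfSpace_vanishing hW hWlaw (R₁ := 1) (fun φ hφ hsupp => ?_) hWsing
  obtain ⟨L, hL⟩ := exists_tendsto_pairing_finalSlice hW hWlaw hφ
  suffices hL0 : L = 0 by rwa [hL0] at hL
  have hex : ∀ j, ∃ Tj : ℝ, Tendsto (fun t => ∫ x, ⟪v (ψs j) t x, φ x⟫) (𝓝[<] 0) (𝓝 Tj) :=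
    fun j => exists_tendsto_pairing_finalSlice (hv (ψs j)) (hvlaw (ψs j)) hφ
  choose Tj hTj using hex
  have hconv : Tendsto Tj atTop (𝓝 L) :=
    tendsto_trace_of_tendsto_slices hφ (fun j => hv (ψs j)) (fun j => hvlaw (ψs j)) hW hWlaw
      (fun t ht x => hpt t ht x) hTj hL
  set I : ℝ := (∫ x, ‖φ x‖ ^ (3 / 2 : ℝ)) ^ (2 / 3 : ℝ) with hI
  have hbound : ∀ j, |Tj j| ≤ 1 / ((ψs j : ℝ) + 1) * I := fun j =>
    hvsmall (ψs j) φ hφ hsupp (Tj j) (hTj j)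
  have hzero : Tendsto Tj atTop (𝓝 0) := by
    have hmaj : Tendsto (fun j => 1 / ((ψs j : ℝ) + 1) * I) atTop (𝓝 0) := by
      have h1 : Tendsto (fun j => 1 / ((ψs j : ℝ) + 1)) atTop (𝓝 0) := by
        have h2 : Tendsto (fun j => (ψs j : ℝ) + 1) atTop atTop :=
          tendsto_atTop_add_const_right _ _ (tendsto_natCast_atTop_atTop.comp hψt)
        exact tendsto_const_nhds.div_atTop h2
      simpa using h1.mul_const I
    exact squeeze_zero_norm (fun j => by rw [Real.norm_eq_abs]; exact hbound j) hmaj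
  exact tendsto_nhds_unique hconv hzero

/-- **PORTRAIT ENTRY (both stubs): uniform `L³`-floor on every half-space.** There is
`ε₂ = ε₂(C,K) > 0` such that the final datum of every SINGULAR member of `𝒟_{C,K}` has, on every
half-space `{x₃ > R}`, a test field `ψ` with `|T_u(ψ)| > ε₂ ‖ψ‖_{L^{3/2}}`. -/
theorem trace_L3_halfSpace_floor_of_singular (C K : ℝ) : ∃ ε₂ > 0,
    ∀ (u : ℝ → EuclideanSpace ℝ (Fin 3) → EuclideanSpace ℝ (Fin 3)),
      IsTypeIAncientMild C u →
      (∀ s : ℝ, s < 0 → ∫⁻ x, ‖fderiv ℝ (u s) x‖ₑ ^ 2 ≤ ENNReal.ofReal (K / Real.sqrt (-s))) →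
      (∀ r > 0, ∀ M : ℝ, ∃ t ∈ Set.Ioo (-(r ^ 2)) (0 : ℝ),
          ∃ x ∈ Metric.ball (0 : EuclideanSpace ℝ (Fin 3)) r, M < ‖u t x‖) →
      ∀ R > 0, ∃ (ψ : EuclideanSpace ℝ (Fin 3) → EuclideanSpace ℝ (Fin 3)) (T : ℝ),
        FunctionSpaces.IsTestFunctionOn (⊤ : Opens (EuclideanSpace ℝ (Fin 3))) ψ ∧
          (∀ x, ψ x ≠ 0 → R < x 2) ∧
          Tendsto (fun t => ∫ x, ⟪u t x, ψ x⟫) (𝓝[<] 0) (𝓝 T) ∧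
          ε₂ * (∫ x, ‖ψ x‖ ^ (3 / 2 : ℝ)) ^ (2 / 3 : ℝ) < |T| := by
  obtain ⟨ε₂, hε₂, h⟩ := exists_trace_epsilon_halfSpace C K
  refine ⟨ε₂, hε₂, fun u hu hlaw hsing R hR => ?_⟩
  by_contra hno
  push Not at hno
  exact h u hu hlaw R hR (fun ψ hψ hs T hT => hno ψ T hψ hs hT) hsing

/-! ### Bookkeeping -/

/-- **The crux is equivalent to its restriction to members whose final datum is nontrivial in
every half-space `{x₃ > R₁}`.** -/
theorem finiteDissipationLiouville_iff_halfSpaceTrace :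
    Theses.LerayQuarterDissipation.FiniteDissipationLiouville ↔
      ∀ (C K : ℝ) (ū : ℝ → EuclideanSpace ℝ (Fin 3) → EuclideanSpace ℝ (Fin 3)),
        IsTypeIAncientMild C ū →
        (∀ s : ℝ, s < 0 → ∫⁻ x, ‖fderiv ℝ (ū s) x‖ₑ ^ 2 ≤ ENNReal.ofReal (K / Real.sqrt (-s))) →
        (∀ R₁ : ℝ, ∃ (φ : EuclideanSpace ℝ (Fin 3) → EuclideanSpace ℝ (Fin 3)) (L : ℝ),
          FunctionSpaces.IsTestFunctionOn (⊤ : Opens (EuclideanSpace ℝ (Fin 3))) φ ∧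
            (∀ x, φ x ≠ 0 → R₁ < x 2) ∧ L ≠ 0 ∧
            Tendsto (fun t => ∫ x, ⟪ū t x, φ x⟫) (𝓝[<] 0) (𝓝 L)) →
        ¬ (∀ r > 0, ∀ M : ℝ, ∃ t ∈ Set.Ioo (-(r ^ 2)) (0 : ℝ),
            ∃ x ∈ Metric.ball (0 : EuclideanSpace ℝ (Fin 3)) r, M < ‖ū t x‖) := by
  constructor
  · intro h C K ū hū hD _
    exact h C K ū hū hD
  · intro h C K ū hū hD hsing
    exact h C K ū hū hD (exists_halfSpace_trace_ne_zero_of_singular hū hD hsing) hsing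

end Summit.NavierStokesRegularity.NavierStokesRegularity.Theorems.FiniteDissipationLiouville.Birth.Apex

end
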